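import Mathlib
import HarnessLib
import Literature.NumberTheory.Transcendental.PennerWeilPeterssonVolumesProofs
import Literature.Analysis.SpecialFunctions.TanhPartialFractions

/-!
# Logarithmic Integral Identities for Far-Field Estimates

This file proves key integral identities used in the far log-kernel bounds:

1. `integral_log_div_one_sub_sq_Ioo_eq_neg_pi_sq_div_8`:
   ∫₀¹ log(v)/(1-v²) dv = -π²/8

2. `integral_log_div_one_sub_sq_Ioi_eq_neg_pi_sq_div_8`:
   ∫₁^∞ log(v)/(1-v²) dv = -π²/8 (via v→1/v symmetry)

3. `integral_log_div_one_sub_sq_pv_eq_neg_pi_sq_div_4`: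
   The principal value integral over (0,∞) equals -π²/4

These identities are used in the drift term computation for the Abel far-field bound
in the Remainder0Xi crux of the EarlyAppointments route.

## References
- `Literature.NumberTheory.Transcendental.lintegral_neg_log_div_one_sub_sq`: the (0,1) integral as Lebesgue
- `Literature.Analysis.SpecialFunctions.hasSum_one_div_odd_sq`: Σ 1/(2k+1)² = π²/8
-/

set_option linter.dupNamespace false
namespace Summit.RiemannHypothesis.RiemannHypothesis.Theorems.EarlyAppointmentsRemainder0Xi

open scoped BigOperators Topology Classical
open Real Complex MeasureTheory Set Filter

/-! ## Integrability helper -/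

/-- A real function whose positive and negative parts have finite `lintegral`s is integrable. -/
theorem integrable_of_lintegral_ofReal_ne_top {α : Type*} [MeasurableSpace α] {μ : Measure α}
    {f : α → ℝ} (hf : Measurable f) (hpos : ∫⁻ x, ENNReal.ofReal (f x) ∂μ ≠ ⊤)
    (hneg : ∫⁻ x, ENNReal.ofReal (-f x) ∂μ ≠ ⊤) : Integrable f μ := by
  refine ⟨hf.aestronglyMeasurable, ?_⟩
  rw [MeasureTheory.hasFiniteIntegral_iff_enorm]
  have hle : ∀ x, ‖f x‖ₑ ≤ ENNReal.ofReal (f x) + ENNReal.ofReal (-f x) := by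
    intro x
    rw [Real.enorm_eq_ofReal_abs]
    rcases le_total 0 (f x) with h | h
    · rw [abs_of_nonneg h]; exact le_self_add
    · rw [abs_of_nonpos h]; exact le_add_self
  calc ∫⁻ x, ‖f x‖ₑ ∂μ ≤ ∫⁻ x, ENNReal.ofReal (f x) + ENNReal.ofReal (-f x) ∂μ := lintegral_mono hle
    _ = ∫⁻ x, ENNReal.ofReal (f x) ∂μ + ∫⁻ x, ENNReal.ofReal (-f x) ∂μ :=
        lintegral_add_left (ENNReal.measurable_ofReal.comp hf) _
    _ < ⊤ := ENNReal.add_lt_top.2 ⟨hpos.lt_top, hneg.lt_top⟩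

/-! ## The (0,1) integral -/

/-- ∫₀¹ log(v)/(1-v²) dv = -π²/8 as a Bochner integral. -/
theorem integral_log_div_one_sub_sq_Ioo_eq_neg_pi_sq_div_8 :
    ∫ v in Ioo (0 : ℝ) 1, Real.log v / (1 - v ^ 2) = -π ^ 2 / 8 := by
  have hint : IntegrableOn (fun v => -Real.log v / (1 - v ^ 2)) (Ioo (0 : ℝ) 1) := by
    rw [IntegrableOn]
    apply integrable_of_lintegral_ofReal_ne_top
    · exact (Real.measurable_log.neg).div (measurable_const.sub (measurable_id.pow_const 2))
    · rw [Literature.NumberTheory.Transcendental.lintegral_neg_log_div_one_sub_sq]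
      exact ENNReal.ofReal_ne_top
    · have h0 : ∀ v ∈ Ioo (0 : ℝ) 1, 0 ≤ -Real.log v / (1 - v ^ 2) := fun v hv => by
        apply div_nonneg
        · exact neg_nonneg.2 (Real.log_nonpos hv.1.le hv.2.le)
        · have hsq : v ^ 2 < 1 := by nlinarith [hv.1, hv.2]
          linarith
      have hae : ∀ᵐ v ∂(volume.restrict (Ioo 0 1)), ENNReal.ofReal (-(-Real.log v / (1 - v ^ 2))) = 0 := by
        filter_upwards [ae_restrict_mem measurableSet_Ioo] with v hv
        have heq : -(-Real.log v / (1 - v ^ 2)) = Real.log v / (1 - v ^ 2) := by ring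
        rw [heq, ENNReal.ofReal_eq_zero]
        have hneg : Real.log v / (1 - v ^ 2) ≤ 0 := by
          apply div_nonpos_of_nonpos_of_nonneg
          · exact Real.log_nonpos hv.1.le hv.2.le
          · have hsq : v ^ 2 < 1 := by nlinarith [hv.1, hv.2]
            linarith
        exact hneg
      rw [lintegral_congr_ae hae, lintegral_zero]; exact ENNReal.zero_ne_top
  have hbochner : ∫ v in Ioo (0 : ℝ) 1, -Real.log v / (1 - v ^ 2) = π ^ 2 / 8 := by
    have hnn : ∀ᵐ v ∂(volume.restrict (Ioo 0 1)), 0 ≤ -Real.log v / (1 - v ^ 2) := by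
      filter_upwards [ae_restrict_mem measurableSet_Ioo] with v hv
      apply div_nonneg
      · exact neg_nonneg.2 (Real.log_nonpos hv.1.le hv.2.le)
      · have hsq : v ^ 2 < 1 := by nlinarith [hv.1, hv.2]
        linarith
    have hmeas : AEStronglyMeasurable (fun v => -Real.log v / (1 - v ^ 2))
        (volume.restrict (Ioo 0 1)) :=
      ((Real.measurable_log.neg).div (measurable_const.sub (measurable_id.pow_const 2))).aestronglyMeasurable
    rw [integral_eq_lintegral_of_nonneg_ae hnn hmeas]
    rw [Literature.NumberTheory.Transcendental.lintegral_neg_log_div_one_sub_sq]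
    rw [ENNReal.toReal_ofReal]; positivity
  have h : ∫ v in Ioo (0 : ℝ) 1, Real.log v / (1 - v ^ 2) =
           -∫ v in Ioo (0 : ℝ) 1, -Real.log v / (1 - v ^ 2) := by
    rw [← integral_neg]; congr 1; ext v; ring
  rw [h, hbochner]; ring

/-! ## The v ↦ 1/v change of variables -/

/-- The image of (0,1) under inversion is (1,∞). -/
private lemma inv_image_Ioo_eq_Ioi : (fun u : ℝ => u⁻¹) '' Ioo 0 1 = Ioi 1 := by
  ext v; simp only [mem_image, mem_Ioo, mem_Ioi]
  constructor
  · rintro ⟨u, ⟨hu0, hu1⟩, rfl⟩; exact (one_lt_inv₀ hu0).2 hu1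
  · intro hv; use v⁻¹; refine ⟨⟨by positivity, inv_lt_one_of_one_lt₀ hv⟩, inv_inv v⟩

/-- Derivative of inversion on (0,1). -/
private lemma hasDerivWithinAt_inv_Ioo (u : ℝ) (hu : u ∈ Ioo (0 : ℝ) 1) :
    HasDerivWithinAt (fun x : ℝ => x⁻¹) (-(u ^ 2)⁻¹) (Ioo 0 1) u := by
  have hne : u ≠ 0 := hu.1.ne'
  exact (hasDerivAt_inv hne).hasDerivWithinAt

/-- Inversion is injective on (0,1). -/
private lemma injOn_inv_Ioo : InjOn (fun u : ℝ => u⁻¹) (Ioo (0 : ℝ) 1) := inv_injective.injOn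

/-- Absolute value of the negative inverse square. -/
private lemma abs_neg_inv_sq (u : ℝ) (hu : 0 < u) : |-(u ^ 2)⁻¹| = (u ^ 2)⁻¹ := by
  rw [abs_neg]; exact abs_of_pos (by positivity)

/-- The key algebraic identity: log(1/u)/(1-1/u²)·(1/u²) = log(u)/(1-u²) for 0 < u < 1. -/
private lemma log_div_one_sub_sq_inv_transform (u : ℝ) (hu0 : 0 < u) (hu1 : u < 1) :
    Real.log u⁻¹ / (1 - u⁻¹ ^ 2) * (u ^ 2)⁻¹ = Real.log u / (1 - u ^ 2) := by
  have hne : u ≠ 0 := hu0.ne'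
  have hu2ne : u ^ 2 ≠ 0 := pow_ne_zero 2 hne
  have h1u2 : 1 - u ^ 2 ≠ 0 := by nlinarith
  have hu2m1ne : u ^ 2 - 1 ≠ 0 := by nlinarith
  have hinv2ne : 1 - u⁻¹ ^ 2 ≠ 0 := by
    simp only [inv_pow, ne_eq]
    intro h
    have hc : (u ^ 2)⁻¹ = 1 := by linarith
    have hd : u ^ 2 = 1 := inv_eq_one.mp hc
    nlinarith
  rw [Real.log_inv]
  have hinvsq : 1 - u⁻¹ ^ 2 = (u ^ 2 - 1) / u ^ 2 := by rw [inv_pow]; field_simp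
  rw [hinvsq, div_div_eq_mul_div]
  have hm1u2 : -1 + u ^ 2 ≠ 0 := by nlinarith
  field_simp [hm1u2]; ring

/-- The integrand transforms correctly under v = 1/u: |f'(u)|·g(f(u)) = g(u). -/
private lemma integrand_transform (u : ℝ) (hu : u ∈ Ioo (0 : ℝ) 1) :
    |-(u ^ 2)⁻¹| • (Real.log u⁻¹ / (1 - u⁻¹ ^ 2)) = Real.log u / (1 - u ^ 2) := by
  rw [abs_neg_inv_sq u hu.1, smul_eq_mul, mul_comm]
  exact log_div_one_sub_sq_inv_transform u hu.1 hu.2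

/-- Change of variables: ∫_{(1,∞)} = ∫_{(0,1)} via v = 1/u. -/
private theorem integral_Ioi_eq_integral_Ioo :
    ∫ v in Ioi (1 : ℝ), Real.log v / (1 - v ^ 2) =
    ∫ u in Ioo (0 : ℝ) 1, Real.log u / (1 - u ^ 2) := by
  have hS : MeasurableSet (Ioo (0 : ℝ) 1) := measurableSet_Ioo
  have hderiv : ∀ u ∈ Ioo (0 : ℝ) 1, HasDerivWithinAt (fun x => x⁻¹) (-(u ^ 2)⁻¹) (Ioo 0 1) u :=
    fun u hu => hasDerivWithinAt_inv_Ioo u hu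
  have hinj : InjOn (fun u : ℝ => u⁻¹) (Ioo 0 1) := injOn_inv_Ioo
  calc ∫ v in Ioi (1 : ℝ), Real.log v / (1 - v ^ 2)
      = ∫ v in (fun u : ℝ => u⁻¹) '' Ioo 0 1, Real.log v / (1 - v ^ 2) := by rw [inv_image_Ioo_eq_Ioi]
    _ = ∫ u in Ioo (0 : ℝ) 1, |-(u ^ 2)⁻¹| • (Real.log u⁻¹ / (1 - u⁻¹ ^ 2)) := by
          rw [MeasureTheory.integral_image_eq_integral_abs_deriv_smul hS hderiv hinj]
    _ = ∫ u in Ioo (0 : ℝ) 1, Real.log u / (1 - u ^ 2) := by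
          refine setIntegral_congr_fun hS fun u hu => ?_; exact integrand_transform u hu

/-- ∫₁^∞ log(v)/(1-v²) dv = -π²/8, by v→1/v symmetry. -/
theorem integral_log_div_one_sub_sq_Ioi_eq_neg_pi_sq_div_8 :
    ∫ v in Ioi (1 : ℝ), Real.log v / (1 - v ^ 2) = -π ^ 2 / 8 := by
  rw [integral_Ioi_eq_integral_Ioo]
  exact integral_log_div_one_sub_sq_Ioo_eq_neg_pi_sq_div_8

/-- The principal value integral of log(v)/(1-v²) over (0,∞) equals -π²/4. -/
theorem integral_log_div_one_sub_sq_pv_eq_neg_pi_sq_div_4 :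
    (∫ v in Ioo (0 : ℝ) 1, Real.log v / (1 - v ^ 2)) +
    (∫ v in Ioi (1 : ℝ), Real.log v / (1 - v ^ 2)) = -π ^ 2 / 4 := by
  have h1 := integral_log_div_one_sub_sq_Ioo_eq_neg_pi_sq_div_8
  have h2 := integral_log_div_one_sub_sq_Ioi_eq_neg_pi_sq_div_8
  have h := congrArg₂ (· + ·) h1 h2
  calc _ = (-π ^ 2 / 8) + (-π ^ 2 / 8) := h
    _ = -π ^ 2 / 4 := by ring

end Summit.RiemannHypothesis.RiemannHypothesis.Theorems.EarlyAppointmentsRemainder0Xi
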